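import Literature.AnabelianGeometry.AbsoluteAnabelian.MLFGaloisCategories
import Literature.AnabelianGeometry.AbsoluteAnabelian.MLFClosureUnitsAnchorProofs
import Literature.AnabelianGeometry.EtaleTheta.KummerMap
import Literature.AlgebraicGeometry.Frobenioids.MonoidFunctors
import Mathlib.GroupTheory.MonoidLocalization.GrothendieckGroup

/-!
# The natural functor `𝒞^MLF_TM → 𝒞^MLF_TLG` (groupification) of [AbsTopIII] Definition 3.1 (iii)

S. Mochizuki, *Topics in absolute anabelian geometry III*, §3, Def. 3.1 (iii) p. 68 (bib key
`MochizukiAbsTopIII2015`; locators = kurims manuscript pages, lit key `paper:url-5493eb38cbb7`):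
"Since the formation of `𝒪_k̄^⊳` (respectively, `k̄^×`; `𝒪_k̄^×`; `𝒪_k̄^×`) from `k̄` (respectively,
`𝒪_k̄^⊳`; `𝒪_k̄^⊳`; `k̄^×`) is clearly intrinsically defined [i.e., depends only on the 'input data of an
object of `T`'], we thus obtain natural functors `𝒞^MLF_TF → 𝒞^MLF_TM`; `𝒞^MLF_TM → 𝒞^MLF_TLG`;
`𝒞^MLF_TM → 𝒞^MLF_TCG`; `𝒞^MLF_TLG → 𝒞^MLF_TCG` — i.e., by taking … the associated groupification `M^gp`
of the arithmetic data `M`, …".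

This file (seat abc-iut-L4-t2, owner of the Def. 3.1 typing `MLFGaloisPairs` / `MLFGaloisCategories`;
sub-DAG row P32.0.r0 of `plan/L4/SUBDAG-AbsTopIII-Prop32.md`, "… on ABSTRACT pairs — UNTYPED
INTERMEDIATE, owner L4-t2") makes the SECOND of these functors a REAL functor on abstract pairs:

* `GaloisMonoidPair.groupification P = (Π ↷ M^gp)` — `M^gp` is Mathlib's Grothendieck group
  `Algebra.GrothendieckGroup M`, with the induced action (the tree's
  `EtaleTheta.grothendieckGroupAction`, installed as the action of the pair) whose point stabilisers are
  open (the stabiliser of `m/s` contains `Stab(m) ∩ Stab(s)`);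
* `GaloisMonoidPair.Iso.groupification`, `GaloisMonoidPair.Hom.groupification` — functoriality on
  isomorphisms of pairs and on morphisms of pairs (Def. 3.1 (ii)); for morphisms the arithmetic
  quotient `Π ↠ G` must be the same for `M` and `M^gp`, which holds as soon as `M → M^gp` is injective
  (`actionKer_groupification`), in particular for MLF-Galois `TM`-pairs (`M ≅ 𝒪_k̄^⊳` is cancellative);
* MODEL: `ModelMLFGaloisData.gpIsoTLG : (Π_k ↷ (𝒪_k̄^⊳)^gp) ⥲ (Π_k ↷ k̄^×)` — the groupification of the
  model `TM`-pair IS the model `TLG`-pair (`(𝒪_k̄^⊳)^gp = k̄^×` because every `x ∈ k̄^×` has `x ∈ 𝒪_k̄` or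
  `x⁻¹ ∈ 𝒪_k̄`: the tree's `MLFClosure.mem_nonzeroIntegers_or_inv_mem`);
* hence `isMLFGaloisMonoidPair_TLG_groupification : P ∈ 𝒞^MLF_TM ⟹ P^gp ∈ 𝒞^MLF_TLG` and the functor
  `tmToTLG : MLFGaloisMonoidPairCat TM ⥤ MLFGaloisMonoidPairCat TLG`, compatible with the forgetful
  assignment `(Π ↷ M) ↦ Π` on the nose (`tmToTLG_homPi`).

Reused, not restated: `Frobenioids.gpMap` (+ `_of/_id/_comp`, functoriality of `M^gp`),
`EtaleTheta.grothendieckGroupAction` / `EtaleTheta.smul_of`, `GaloisMonoidPair.mem_actionKer_iff`,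
`MLFClosure.mem_nonzeroIntegers_or_inv_mem`.  Small new API: `GaloisMonoidPair.Iso.symm` / `.trans`
(Def. 3.1 (ii); `Iso.refl` is in `MLFGaloisModelPairs`; the same inverse construction appears as
`Iso.symm'` in the Prop. 3.2 (iv) proofs file `MonoidKummerMapsIdRigidProofs`, which imports the
Prop. 3.2 statements and is not imported at the Def. 3.1 level), `gp_monoidHom_ext`, `gpMapEquiv`.
Deliberately NOT here: `𝒞_TF → 𝒞_TM` (needs the intrinsic `𝒪^⊳` of a `TF`-pair, file
`MLFGaloisIntrinsic`), `𝒞_TM → 𝒞_TCG` and `𝒞_TLG → 𝒞_TCG` (file `MLFGaloisUnitsFunctors`), the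
log-Frobenius functors of Def. 3.1 (iv) (seat abc-iut-L4-t9).
HONEST FRAMING: OUR kernel constructions of classical objects named by a refereed 2015 paper; nothing
here bears on [IUTchIII] Cor. 3.12; typed ≠ proved for anything downstream.
-/

noncomputable section

universe u

namespace Literature.AnabelianGeometry.AbsoluteAnabelian

open _root_.CategoryTheory Algebra
open _root_.ValuativeRel
open Literature.NumberTheory.GaloisRepresentations
open Literature.AlgebraicGeometry.Frobenioids (gpMap gpMap_of gpMap_id gpMap_comp gpMap_comp_of)

attribute [local instance] Literature.AnabelianGeometry.EtaleTheta.grothendieckGroupAction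

/-! ### Complements on the Grothendieck group `M ↦ M^gp` (commutative monoids) -/

section Groupification

variable {M N : Type u} [CommMonoid M] [CommMonoid N]

/-- Two monoid homomorphisms out of `M^gp` (into any monoid) that agree on `M` are equal.
[cite: MochizukiAbsTopIII2015, Definition 3.1 (iii) p.68] -/
theorem gp_monoidHom_ext {R : Type*} [Monoid R] {f g : GrothendieckGroup M →* R}
    (h : f.comp GrothendieckGroup.of = g.comp GrothendieckGroup.of) : f = g :=
  (Localization.monoidOf ⊤).epic_of_localizationMap h

/-- In `M^gp`, the class of `(m, s)` is `m / s`. [cite: MochizukiAbsTopIII2015, Definition 3.1 (iii) p.68] -/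
theorem gp_mk_eq_of_div_of (m : M) (s : (⊤ : Submonoid M)) :
    (Localization.mk m s : GrothendieckGroup M) =
      GrothendieckGroup.of m / GrothendieckGroup.of (s : M) := by
  rw [eq_div_iff_mul_eq', Localization.mk_eq_monoidOf_mk'_apply]
  exact (Localization.monoidOf ⊤).mk'_spec m s

/-- A monoid isomorphism `M ≃ N` induces `M^gp ≃ N^gp`. [cite: MochizukiAbsTopIII2015, Definition 3.1 (iii) p.68] -/
def gpMapEquiv (e : M ≃* N) : GrothendieckGroup M ≃* GrothendieckGroup N :=
  MonoidHom.toMulEquiv (gpMap e.toMonoidHom) (gpMap e.symm.toMonoidHom)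
    (by
      rw [← gpMap_comp]
      convert gpMap_id (M := M) using 2
      exact MonoidHom.ext fun x => e.symm_apply_apply x)
    (by
      rw [← gpMap_comp]
      convert gpMap_id (M := N) using 2
      exact MonoidHom.ext fun x => e.apply_symm_apply x)

/-- The underlying homomorphism of `gpMapEquiv e` is `gpMap e`. [cite: MochizukiAbsTopIII2015, Definition 3.1 (iii) p.68] -/
theorem gpMapEquiv_apply (e : M ≃* N) (x : GrothendieckGroup M) :
    gpMapEquiv e x = gpMap e.toMonoidHom x := rfl

variable {G : Type*} [Group G] [MulDistribMulAction G M]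

/-- The induced action on `M^gp` (`EtaleTheta.grothendieckGroupAction`) is `(g • ·)^gp`
(definitional). [cite: MochizukiAbsTopIII2015, Definition 3.1 (iii) p.68] -/
theorem gp_smul_def (g : G) (x : GrothendieckGroup M) :
    g • x = gpMap (MulDistribMulAction.toMonoidHom M g) x := rfl

/-- The induced action on `m / s` is `(g • m) / (g • s)`. [cite: MochizukiAbsTopIII2015, Definition 3.1 (iii) p.68] -/
theorem gp_smul_mk (g : G) (m : M) (s : (⊤ : Submonoid M)) :
    g • (Localization.mk m s : GrothendieckGroup M) =
      GrothendieckGroup.of (g • m) / GrothendieckGroup.of (g • (s : M)) := by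
  rw [gp_mk_eq_of_div_of, smul_div', EtaleTheta.smul_of, EtaleTheta.smul_of]

end Groupification

/-! ### Def 3.1 (ii): inverse and composite isomorphisms of pairs -/

namespace GaloisMonoidPair

variable {P Q R : GaloisMonoidPair.{u}}

/-- The inverse of an isomorphism of pairs. [cite: MochizukiAbsTopIII2015, Definition 3.1 (ii) p.67] -/
def Iso.symm (e : GaloisMonoidPair.Iso P Q) : GaloisMonoidPair.Iso Q P where
  isoPi := e.isoPi.symm
  isoM := e.isoM.symm
  smul_comm g y := by
    apply e.isoM.injective
    obtain ⟨x, rfl⟩ := e.isoM.surjective y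
    obtain ⟨h, rfl⟩ := e.isoPi.surjective g
    simp [e.smul_comm]

/-- The composite of two isomorphisms of pairs. [cite: MochizukiAbsTopIII2015, Definition 3.1 (ii) p.67] -/
def Iso.trans (e : GaloisMonoidPair.Iso P Q) (f : GaloisMonoidPair.Iso Q R) : GaloisMonoidPair.Iso P R where
  isoPi := e.isoPi.trans f.isoPi
  isoM := e.isoM.trans f.isoM
  smul_comm g x := by
    change f.isoM (e.isoM (g • x)) = f.isoPi (e.isoPi g) • f.isoM (e.isoM x)
    rw [e.smul_comm, f.smul_comm]

/-! ### Def 3.1 (iii): the groupification `(Π ↷ M) ↦ (Π ↷ M^gp)` of a pair -/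

variable (P)

/-- **Def 3.1 (iii), `𝒞_TM → 𝒞_TLG` on objects: the groupification `(Π ↷ M^gp)` of a pair `(Π ↷ M)`**
("the associated groupification `M^gp` of the arithmetic data `M`"), with the induced action; its point
stabilisers are open because the stabiliser of `m / s` contains `Stab(m) ∩ Stab(s)`.
[cite: MochizukiAbsTopIII2015, Definition 3.1 (iii) p.68] -/
def groupification : GaloisMonoidPair.{u} where
  Pi := P.Pi
  M := GrothendieckGroup P.M
  instAction := EtaleTheta.grothendieckGroupAction P.Pi P.M
  isOpen_stabilizer x := by
    induction x using Localization.induction_on with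
    | H y =>
      obtain ⟨m, s⟩ := y
      refine Subgroup.isOpen_mono (H₁ := MulAction.stabilizer P.Pi m ⊓ MulAction.stabilizer P.Pi (s : P.M))
        ?_ ?_
      · intro g hg
        rw [Subgroup.mem_inf, MulAction.mem_stabilizer_iff, MulAction.mem_stabilizer_iff] at hg
        rw [MulAction.mem_stabilizer_iff, gp_smul_mk, hg.1, hg.2, ← gp_mk_eq_of_div_of]
      · rw [Subgroup.coe_inf]
        exact (P.isOpen_stabilizer m).inter (P.isOpen_stabilizer (s : P.M))

/-- The topological group of `P.groupification` is that of `P`: the forgetful assignment `(Π ↷ M) ↦ Π`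
is unchanged. [cite: MochizukiAbsTopIII2015, Definition 3.1 (iii) p.68] -/
theorem groupification_Pi : P.groupification.Pi = P.Pi := rfl

/-- The arithmetic data of `P.groupification` is `M^gp`. [cite: MochizukiAbsTopIII2015, Definition 3.1 (iii) p.68] -/
theorem groupification_M : P.groupification.M = GrothendieckGroup P.M := rfl

/-- The action of `P.groupification` is the induced action `(g • ·)^gp` on `M^gp` (definitional).
[cite: MochizukiAbsTopIII2015, Definition 3.1 (iii) p.68] -/
theorem groupification_smul_eq (g : P.Pi) (x : GrothendieckGroup P.M) :
    (HSMul.hSMul (α := P.groupification.Pi) (β := P.groupification.M) g x) = g • x := rfl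

/-- `g` acts trivially on `M` ⟹ `g` acts trivially on `M^gp`. [cite: MochizukiAbsTopIII2015, Definition 3.1 (iii) p.68] -/
theorem actionKer_le_actionKer_groupification : P.actionKer ≤ P.groupification.actionKer := by
  intro g hg
  have hg' := (P.mem_actionKer_iff g).mp hg
  refine (P.groupification.mem_actionKer_iff g).mpr fun x => ?_
  change HSMul.hSMul (α := P.Pi) (β := GrothendieckGroup P.M) g x = x
  induction x using Localization.induction_on with
  | H y =>
    obtain ⟨m, s⟩ := y
    rw [gp_smul_mk, hg', hg', ← gp_mk_eq_of_div_of]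

/-- If `M → M^gp` is injective (e.g. `M` cancellative), the arithmetic quotients `Π ↠ G` of `(Π ↷ M)` and
`(Π ↷ M^gp)` coincide. [cite: MochizukiAbsTopIII2015, Definition 3.1 (iii) p.68] -/
theorem actionKer_groupification
    (hof : Function.Injective (GrothendieckGroup.of : P.M → GrothendieckGroup P.M)) :
    P.groupification.actionKer = P.actionKer := by
  refine le_antisymm ?_ P.actionKer_le_actionKer_groupification
  intro g hg
  have hg' := (P.groupification.mem_actionKer_iff g).mp hg
  refine (P.mem_actionKer_iff g).mpr fun m => ?_
  apply hof
  rw [← EtaleTheta.smul_of]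
  exact hg' (GrothendieckGroup.of m)

variable {P}

/-- **Functoriality on isomorphisms of pairs**: `(Π ↷ M) ≅ (Π' ↷ M')` induces
`(Π ↷ M^gp) ≅ (Π' ↷ M'^gp)`. [cite: MochizukiAbsTopIII2015, Definition 3.1 (iii) p.68] -/
def Iso.groupification (e : GaloisMonoidPair.Iso P Q) :
    GaloisMonoidPair.Iso P.groupification Q.groupification where
  isoPi := e.isoPi
  isoM := gpMapEquiv e.isoM
  smul_comm g x := by
    change gpMap e.isoM.toMonoidHom (gpMap (MulDistribMulAction.toMonoidHom (M := P.Pi) P.M g) x) =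
      gpMap (MulDistribMulAction.toMonoidHom (M := Q.Pi) Q.M (e.isoPi g)) (gpMap e.isoM.toMonoidHom x)
    rw [← MonoidHom.comp_apply, ← gpMap_comp, ← MonoidHom.comp_apply, ← gpMap_comp]
    congr 2
    exact MonoidHom.ext fun m => e.smul_comm g m

/-- The Galois component of `e.groupification` is that of `e`. [cite: MochizukiAbsTopIII2015, Definition 3.1 (iii) p.68] -/
@[simp] theorem Iso.groupification_isoPi (e : GaloisMonoidPair.Iso P Q) : e.groupification.isoPi = e.isoPi := rfl

/-- The object component of `e.groupification` is `(e_M)^gp`. [cite: MochizukiAbsTopIII2015, Definition 3.1 (iii) p.68] -/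
theorem Iso.groupification_isoM_apply (e : GaloisMonoidPair.Iso P Q) (x : P.groupification.M) :
    e.groupification.isoM x = gpMap e.isoM.toMonoidHom x := rfl

/-- **Functoriality on morphisms of pairs** (Def 3.1 (ii)): `φ = (φ_Π, φ_M)` induces `(φ_Π, φ_M^gp)`; the
open-injectivity condition on arithmetic Galois groups is inherited because the arithmetic kernels of
`M` and `M^gp` agree when `M ↪ M^gp`. [cite: MochizukiAbsTopIII2015, Definition 3.1 (iii) p.68] -/
def Hom.groupification (φ : P.Hom Q)
    (hP : Function.Injective (GrothendieckGroup.of : P.M → GrothendieckGroup P.M))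
    (hQ : Function.Injective (GrothendieckGroup.of : Q.M → GrothendieckGroup Q.M)) :
    P.groupification.Hom Q.groupification where
  homPi := φ.homPi
  continuous_homPi := φ.continuous_homPi
  homM := gpMap φ.homM
  smul_comm g x := by
    change gpMap φ.homM (gpMap (MulDistribMulAction.toMonoidHom (M := P.Pi) P.M g) x) =
      gpMap (MulDistribMulAction.toMonoidHom (M := Q.Pi) Q.M (φ.homPi g)) (gpMap φ.homM x)
    rw [← MonoidHom.comp_apply, ← gpMap_comp, ← MonoidHom.comp_apply, ← gpMap_comp]
    congr 2
    exact MonoidHom.ext fun m => φ.smul_comm g m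
  comap_ker := by
    rw [Q.actionKer_groupification hQ, P.actionKer_groupification hP]
    exact φ.comap_ker
  isOpen_image U hU := by
    rw [Q.actionKer_groupification hQ]
    exact φ.isOpen_image U hU

/-- The Galois component of `φ.groupification` is `φ_Π`. [cite: MochizukiAbsTopIII2015, Definition 3.1 (iii) p.68] -/
@[simp] theorem Hom.groupification_homPi (φ : P.Hom Q) (hP hQ) :
    (φ.groupification hP hQ).homPi = φ.homPi := rfl

/-- The object component of `φ.groupification` is `φ_M^gp`. [cite: MochizukiAbsTopIII2015, Definition 3.1 (iii) p.68] -/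
@[simp] theorem Hom.groupification_homM (φ : P.Hom Q) (hP hQ) :
    (φ.groupification hP hQ).homM = gpMap φ.homM := rfl

end GaloisMonoidPair

/-! ### The model: `(𝒪_k̄^⊳)^gp = k̄^×` -/

namespace ModelMLFGaloisData

variable {k : Type u} [Field k] [ValuativeRel k] {K : Type u} [Field K] [Algebra k K]

/-- `𝒪_k̄^⊳ → k̄ˣ`, `m ↦ m`, as a monoid homomorphism (bundling `toUnit`).
[cite: MochizukiAbsTopIII2015, Definition 3.1 (i) p.66] -/
def toUnitHom : nonzeroIntegers k K →* Kˣ where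
  toFun := toUnit
  map_one' := Units.ext rfl
  map_mul' := toUnit_mul

/-- `toUnitHom` on elements. [cite: MochizukiAbsTopIII2015, Definition 3.1 (i) p.66] -/
@[simp] theorem toUnitHom_apply (m : nonzeroIntegers k K) : toUnitHom m = toUnit m := rfl

/-- **`(𝒪_k̄^⊳)^gp → k̄^×`**: the homomorphism induced on the groupification by `𝒪_k̄^⊳ ⊆ k̄^×`
(`k̄^× = nonZeroDivisors k̄`, the arithmetic data of the model `TLG`-pair).
[cite: MochizukiAbsTopIII2015, Definition 3.1 (iii) p.68] -/
def gpToNonZeroDivisors : GrothendieckGroup (nonzeroIntegers k K) →* nonZeroDivisors K :=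
  (nonZeroDivisorsEquivUnits (G₀ := K)).symm.toMonoidHom.comp (GrothendieckGroup.lift toUnitHom)

/-- `gpToNonZeroDivisors` extends the inclusion `𝒪_k̄^⊳ ⊆ k̄^×`. [cite: MochizukiAbsTopIII2015, Definition 3.1 (iii) p.68] -/
@[simp] theorem gpToNonZeroDivisors_of (m : nonzeroIntegers k K) :
    (gpToNonZeroDivisors (GrothendieckGroup.of m) : K) = m := by
  unfold gpToNonZeroDivisors
  rw [MonoidHom.comp_apply]
  have h : GrothendieckGroup.lift toUnitHom (GrothendieckGroup.of m) = toUnit m :=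
    (Localization.monoidOf ⊤).lift_eq _ m
  rw [h]
  rfl

/-- `gpToNonZeroDivisors` on `m / s` is `m / s ∈ k̄^×`. [cite: MochizukiAbsTopIII2015, Definition 3.1 (iii) p.68] -/
theorem gpToNonZeroDivisors_mk (m : nonzeroIntegers k K) (s : (⊤ : Submonoid (nonzeroIntegers k K))) :
    (gpToNonZeroDivisors (Localization.mk m s) : K) = (m : K) / ((s : nonzeroIntegers k K) : K) := by
  rw [eq_div_iff (s : nonzeroIntegers k K).2.2]
  have h : gpToNonZeroDivisors (Localization.mk m s) *
      gpToNonZeroDivisors (GrothendieckGroup.of (s : nonzeroIntegers k K)) =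
        gpToNonZeroDivisors (k := k) (GrothendieckGroup.of m) := by
    rw [← map_mul, Localization.mk_eq_monoidOf_mk'_apply]
    exact congrArg _ ((Localization.monoidOf ⊤).mk'_spec m s)
  have h' := congrArg (fun z : nonZeroDivisors K => (z : K)) h
  simpa only [Submonoid.coe_mul, gpToNonZeroDivisors_of] using h'

/-- `gpToNonZeroDivisors` is injective. [cite: MochizukiAbsTopIII2015, Definition 3.1 (iii) p.68] -/
theorem gpToNonZeroDivisors_injective :
    Function.Injective (gpToNonZeroDivisors (k := k) (K := K)) := by
  intro x y hxy
  induction x using Localization.induction_on with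
  | H a =>
    induction y using Localization.induction_on with
    | H b =>
      obtain ⟨m, s⟩ := a
      obtain ⟨m', s'⟩ := b
      have h := congrArg (fun z : nonZeroDivisors K => (z : K)) hxy
      simp only [gpToNonZeroDivisors_mk] at h
      rw [div_eq_div_iff (s : nonzeroIntegers k K).2.2 (s' : nonzeroIntegers k K).2.2] at h
      rw [Localization.mk_eq_mk_iff, Localization.r_iff_exists]
      refine ⟨1, ?_⟩
      apply Subtype.ext
      simpa [Submonoid.coe_mul, mul_comm] using h

/-- **`(𝒪_k̄^⊳)^gp → k̄^×` is surjective**: every `x ∈ k̄^×` is `m/1` or `1/m` with `m ∈ 𝒪_k̄^⊳` (`𝒪_k̄` is a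
valuation ring of `k̄`: `MLFClosure.mem_nonzeroIntegers_or_inv_mem`). [cite: MochizukiAbsTopIII2015, Definition 3.1 (iii) p.68] -/
theorem gpToNonZeroDivisors_surjective (C : MLFClosure.{u}) :
    Function.Surjective (gpToNonZeroDivisors (k := C.k) (K := C.K)) := by
  intro y
  have hy0 : (y : C.K) ≠ 0 := mem_nonZeroDivisors_iff_ne_zero.mp y.2
  rcases C.mem_nonzeroIntegers_or_inv_mem hy0 with h | h
  · refine ⟨GrothendieckGroup.of ⟨y, h⟩, Subtype.ext ?_⟩
    rw [gpToNonZeroDivisors_of]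
  · refine ⟨Localization.mk 1 ⟨⟨(y : C.K)⁻¹, h⟩, Submonoid.mem_top _⟩, Subtype.ext ?_⟩
    rw [gpToNonZeroDivisors_mk]
    simp

/-- **`(𝒪_k̄^⊳)^gp ⥲ k̄^×`** as a multiplicative isomorphism. [cite: MochizukiAbsTopIII2015, Definition 3.1 (iii) p.68] -/
def gpEquivNonZeroDivisors (C : MLFClosure.{u}) :
    GrothendieckGroup (nonzeroIntegers C.k C.K) ≃* nonZeroDivisors C.K :=
  MulEquiv.ofBijective gpToNonZeroDivisors ⟨gpToNonZeroDivisors_injective, gpToNonZeroDivisors_surjective C⟩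

/-- `gpEquivNonZeroDivisors` is `gpToNonZeroDivisors`. [cite: MochizukiAbsTopIII2015, Definition 3.1 (iii) p.68] -/
@[simp] theorem gpEquivNonZeroDivisors_apply (C : MLFClosure.{u})
    (x : GrothendieckGroup (nonzeroIntegers C.k C.K)) :
    gpEquivNonZeroDivisors C x = gpToNonZeroDivisors x := rfl

variable (C : MLFClosure.{u}) (D : ModelMLFGaloisData C.k C.K)

/-- **The groupification of the model `TM`-pair is the model `TLG`-pair**:
`(Π_k ↷ (𝒪_k̄^⊳)^gp) ⥲ (Π_k ↷ k̄^×)` (identity on `Π_k`, `gpEquivNonZeroDivisors` on the arithmetic data,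
equivariant since both actions are through `ε_k` on `k̄`). [cite: MochizukiAbsTopIII2015, Definition 3.1 (iii) p.68] -/
def gpIsoTLG : GaloisMonoidPair.Iso D.tmPair.groupification D.tlgPair where
  isoPi := ContinuousMulEquiv.refl _
  isoM := gpEquivNonZeroDivisors C
  smul_comm g x := by
    change gpToNonZeroDivisors (gpMap (MulDistribMulAction.toMonoidHom (M := D.Pi) (nonzeroIntegers C.k C.K) g) x) =
      MulDistribMulAction.toMonoidHom (M := D.Pi) (nonZeroDivisors C.K) g (gpToNonZeroDivisors x)
    rw [← MonoidHom.comp_apply,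
      ← MonoidHom.comp_apply (MulDistribMulAction.toMonoidHom (M := D.Pi) (nonZeroDivisors C.K) g)]
    congr 1
    apply gp_monoidHom_ext
    ext m
    simp only [MonoidHom.comp_apply, gpMap_of, gpToNonZeroDivisors_of, MulDistribMulAction.toMonoidHom_apply,
      nonzeroIntegers_coe_smul]
    change D.aug g • (m : C.K) =
      D.aug g • ((gpToNonZeroDivisors (GrothendieckGroup.of m) : nonZeroDivisors C.K) : C.K)
    rw [gpToNonZeroDivisors_of]

/-- **Def 3.1 (iii) preserves MLF-Galois pairs**: the groupification of an MLF-Galois `TM`-pair is an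
MLF-Galois `TLG`-pair (transport the model identification `(𝒪_k̄^⊳)^gp = k̄^×` along the isomorphism with a
model). [cite: MochizukiAbsTopIII2015, Definition 3.1 (iii) p.68] -/
theorem _root_.Literature.AnabelianGeometry.AbsoluteAnabelian.GaloisMonoidPair.isMLFGaloisMonoidPair_TLG_groupification
    {P : GaloisMonoidPair.{u}} (hP : IsMLFGaloisMonoidPair .TM P) :
    IsMLFGaloisMonoidPair .TLG P.groupification := by
  obtain ⟨C, D, Q, hQ, ⟨e⟩⟩ := hP.exists_model
  have hQ' : D.tmPair = Q := Option.some_injective _ (D.monoidPair_TM.symm.trans hQ)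
  subst hQ'
  exact ⟨⟨C, D, D.tlgPair, D.monoidPair_TLG, ⟨(gpIsoTLG C D).symm.trans e.groupification⟩⟩⟩

/-- For an MLF-Galois `TM`-pair, `M → M^gp` is injective (`M ≅ 𝒪_k̄^⊳` is cancellative, being a submonoid
of `k̄` that avoids `0`). [cite: MochizukiAbsTopIII2015, Definition 3.1 (iii) p.68] -/
theorem _root_.Literature.AnabelianGeometry.AbsoluteAnabelian.GaloisMonoidPair.of_injective_of_TM
    {P : GaloisMonoidPair.{u}} (hP : IsMLFGaloisMonoidPair .TM P) :
    Function.Injective (GrothendieckGroup.of : P.M → GrothendieckGroup P.M) := by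
  obtain ⟨C, D, Q, hQ, ⟨e⟩⟩ := hP.exists_model
  have hQ' : D.tmPair = Q := Option.some_injective _ (D.monoidPair_TM.symm.trans hQ)
  subst hQ'
  haveI : IsLeftCancelMul P.M := ⟨fun a b c (h : a * b = a * c) => by
    apply e.isoM.symm.injective
    have h' : e.isoM.symm a * e.isoM.symm b = e.isoM.symm a * e.isoM.symm c := by
      rw [← map_mul, ← map_mul, h]
    exact Subtype.ext (mul_left_cancel₀ (e.isoM.symm a).2.2 (congrArg Subtype.val h'))⟩
  haveI : IsCancelMul P.M := CommMagma.IsLeftCancelMul.toIsCancelMul _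
  exact GrothendieckGroup.of_injective

end ModelMLFGaloisData

/-! ### Def 3.1 (iii): the functor `𝒞^MLF_TM → 𝒞^MLF_TLG` -/

/-- **Def 3.1 (iii): the natural functor `𝒞^MLF_TM → 𝒞^MLF_TLG`, `(Π ↷ M) ↦ (Π ↷ M^gp)`** ("by taking … the
associated groupification `M^gp` of the arithmetic data `M`"), on the categories of Def. 3.1 (iii)
(`MLFGaloisMonoidPairCat`, full subcategories of the category of pairs); on morphisms `(φ_Π, φ_M) ↦ (φ_Π, φ_M^gp)`.
[cite: MochizukiAbsTopIII2015, Definition 3.1 (iii) p.68] -/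
def tmToTLG : MLFGaloisMonoidPairCat.{u} .TM ⥤ MLFGaloisMonoidPairCat.{u} .TLG where
  obj P := ⟨P.obj.groupification, GaloisMonoidPair.isMLFGaloisMonoidPair_TLG_groupification P.property⟩
  map {P Q} φ := InducedCategory.homMk (GaloisMonoidPair.Hom.groupification (P := P.obj) (Q := Q.obj) φ.hom
    (GaloisMonoidPair.of_injective_of_TM P.property) (GaloisMonoidPair.of_injective_of_TM Q.property))
  map_id _ := InducedCategory.Hom.ext (GaloisMonoidPair.Hom.ext rfl gpMap_id)
  map_comp _ _ := InducedCategory.Hom.ext (GaloisMonoidPair.Hom.ext rfl (gpMap_comp _ _))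

/-- `tmToTLG` is compatible with the forgetful assignment `(Π ↷ M) ↦ Π` ON THE NOSE: same topological group,
same `φ_Π` ("compatible natural functors `𝒞^MLF_T → TG`", Def. 3.1 (iii) p.68).
[cite: MochizukiAbsTopIII2015, Definition 3.1 (iii) p.68] -/
theorem tmToTLG_homPi {P Q : MLFGaloisMonoidPairCat.{u} .TM} (φ : P ⟶ Q) :
    (tmToTLG.map φ).hom.homPi = GaloisMonoidPair.Hom.homPi (P := P.obj) (Q := Q.obj) φ.hom := rfl

end Literature.AnabelianGeometry.AbsoluteAnabelian

end
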